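import Summits.MatrixMultiplication.OmegaCensus.DominoZpZpStructSevenKeys
import HarnessLib

/-!
# Structural cover argument for part size `7` on `ZMod p × ZMod p` (`p ≤ 19`): the core

ω-census `pub-omega`, family (b3), seat pub-omega-group gen 24 (part-`7` copy of gen 23's `DominoZpZpStructSixCore.lean`).
Framing: lottery ticket; floor = certified bounds/negative ranges.  VALUE: the part-`7` analogue of the part-`6` core, aimed at
the OPEN census cells `(1,7,23)@484` ×2 (`A ↠ ℤ₁₁²`): for `p ≤ 19` seven points have `21 > p + 1` pair directions, so
(pigeonhole on slopes, `exists_parallel_pairs7`) two pairs are parallel and some pair-collapsing direction has TWO coincidences;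
the rest is the pinning argument of the part-`5`/`6` routes with two finite PAIR PROPERTIES (`h3a`: three equal values, `h3b`:
two disjoint pairs) decided per prime; NOT progress on ω.

Excluded list `E` (per prime: the unit-passing 7-multisets; `p = 11`: 910 count vectors in 91 scaling classes, 76 with a repeat,
every multiplicity `≤ 3`) with hypotheses: no entry `≥ 4` (`hE1`), closure under unit scalings (`hE2`), `h3a`, `h3b`.  An exact
desk check at `p = 11` (`pub-omega-group-g24/code/s7check.py`) finds ≥ 8 good collapses (of ≤ 21) in every pinned
configuration of both families and of the repeated-point family.

**Theorem (`exists_goodS7`).**  For `p + 1 < 21` and such `E`, every `u : Fin 7 → ZMod p × ZMod p` has, after a permutation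
`σ`, a line direction `j ≤ p` with `ℓ(u_{σ0}) = ℓ(u_{σ1})` whose key is not in `E`.  Cases exactly as for part `6`: a repeated
point (three coincident points ⇒ collapse a fourth ⇒ four equal values; else collapse a third ⇒ `goodS7_of_triple`); distinct
points ⇒ parallel pairs `{i,j} ∥ {k,l}`, disjoint (`goodS7_of_twopairs`) or sharing an index (three collinear, `goodS7_of_triple`).
-/

namespace Summit.MatrixMultiplication.OmegaCensus

open Finset

namespace ZpZpDomino

section Core

variable {p : ℕ} [Fact p.Prime]

omit [Fact p.Prime] in
/-- Transport of the goal along a relabelling of the points. [folklore] -/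
private theorem goal_of_perm7 {E : List (List ℕ)} {u : Fin 7 → ZMod p × ZMod p} (τ : Equiv.Perm (Fin 7))
    (h : ∃ j < p + 1, ∃ σ : Equiv.Perm (Fin 7), lineDir p j (u (τ (σ 0))) = lineDir p j (u (τ (σ 1))) ∧
      key7 (fun i => lineDir p j (u (τ (σ i)))) ∉ E) :
    ∃ j < p + 1, ∃ σ : Equiv.Perm (Fin 7), lineDir p j (u (σ 0)) = lineDir p j (u (σ 1)) ∧
      key7 (fun i => lineDir p j (u (σ i))) ∉ E := by
  obtain ⟨j, hj, σ, h1, h2⟩ := h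
  exact ⟨j, hj, σ.trans τ, h1, h2⟩

/-- **The pinning step**: two independent functionals `φ₁ = lmap c₁ c₂` and `φ₂ = lmap w.2 (−w.1)` (`φ₁(w) ≠ 0`) with values
`x, y`, and a pair `i, j` with `(xᵢ, yᵢ) ≠ (xⱼ, yⱼ)` whose combination `(yᵢ−yⱼ)x − (xᵢ−xⱼ)y` has a non-excluded key ⇒ the goal
(the combination is the non-zero functional `(yᵢ−yⱼ)φ₁ − (xᵢ−xⱼ)φ₂`, which collapses `uᵢ, uⱼ`). [folklore] -/
theorem goodS7_of_pair_data {E : List (List ℕ)} (hE2 : ∀ k ∈ E, ∀ κ : ℕ, 1 ≤ κ → κ < p → scaleVec p κ k ∈ E)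
    (u : Fin 7 → ZMod p × ZMod p) (c₁ c₂ : ZMod p) (w : ZMod p × ZMod p) (hD : c₁ * w.1 + c₂ * w.2 ≠ 0) (i j : Fin 7)
    (hne : (lmap c₁ c₂ (u i), lmap w.2 (-w.1) (u i)) ≠ (lmap c₁ c₂ (u j), lmap w.2 (-w.1) (u j)))
    (hm : key7 (fun k => (lmap w.2 (-w.1) (u i) - lmap w.2 (-w.1) (u j)) * lmap c₁ c₂ (u k) -
      (lmap c₁ c₂ (u i) - lmap c₁ c₂ (u j)) * lmap w.2 (-w.1) (u k)) ∉ E) :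
    ∃ j < p + 1, ∃ σ : Equiv.Perm (Fin 7), lineDir p j (u (σ 0)) = lineDir p j (u (σ 1)) ∧
      key7 (fun i => lineDir p j (u (σ i))) ∉ E := by
  set α : ZMod p := lmap w.2 (-w.1) (u i) - lmap w.2 (-w.1) (u j) with hα
  set β : ZMod p := lmap c₁ c₂ (u i) - lmap c₁ c₂ (u j) with hβ
  have hij : i ≠ j := by rintro rfl; exact hne rfl
  have hψval : ∀ k, lmap (α * c₁ - β * w.2) (α * c₂ + β * w.1) (u k) =
      α * lmap c₁ c₂ (u k) - β * lmap w.2 (-w.1) (u k) := by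
    intro k; simp only [lmap_apply]; ring
  have hψne : (α * c₁ - β * w.2) ≠ 0 ∨ (α * c₂ + β * w.1) ≠ 0 := by
    by_contra h
    push Not at h
    obtain ⟨hc1, hc2⟩ := h
    have hαD : α * (c₁ * w.1 + c₂ * w.2) = 0 := by linear_combination w.1 * hc1 + w.2 * hc2
    have hα0 : α = 0 := (mul_eq_zero.1 hαD).resolve_right hD
    rw [hα0, zero_mul, zero_sub, neg_eq_zero] at hc1
    rw [hα0, zero_mul, zero_add] at hc2
    have hw : w ≠ 0 := by rintro rfl; simp at hD
    have hβ0 : β = 0 := by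
      by_contra hb
      apply hw
      exact Prod.ext ((mul_eq_zero.1 hc2).resolve_left hb) ((mul_eq_zero.1 hc1).resolve_left hb)
    exact hne (Prod.ext (sub_eq_zero.1 hβ0) (sub_eq_zero.1 hα0))
  obtain ⟨h0, h1⟩ := pairPerm7_apply i j hij
  refine good_of_lmap7 hE2 u _ _ hψne (pairPerm7 i j) ?_ ?_
  · rw [h0, h1, hψval, hψval, hα, hβ]; ring
  · have e : (fun k => lmap (α * c₁ - β * w.2) (α * c₂ + β * w.1) (u k)) =
        fun k => α * lmap c₁ c₂ (u k) - β * lmap w.2 (-w.1) (u k) := funext hψval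
    rw [e]; exact hm

/-- **Three equal values** `x₀ = x₁ = x₂` along a non-zero functional `φ₁ = lmap c₁ c₂` ⇒ the goal: either the key of `x` is good,
or `x₃ ≠ x₀` (else four equal values), `φ₂` collapses `u₀, u₃`, and either its key is good or the pair property `h3a` pins a good
pair. [folklore] -/
theorem goodS7_of_triple {E : List (List ℕ)} (hE1 : ∀ k ∈ E, ∀ x ∈ k, x ≤ 3)
    (hE2 : ∀ k ∈ E, ∀ κ : ℕ, 1 ≤ κ → κ < p → scaleVec p κ k ∈ E)
    (h3a : ∀ x y : Fin 7 → ZMod p, x 0 = x 1 → x 1 = x 2 → key7 x ∈ E → y 0 = y 3 → key7 y ∈ E →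
      ∃ i j : Fin 7, (x i, y i) ≠ (x j, y j) ∧ key7 (fun k => (y i - y j) * x k - (x i - x j) * y k) ∉ E)
    (u : Fin 7 → ZMod p × ZMod p) (c₁ c₂ : ZMod p) (hc : c₁ ≠ 0 ∨ c₂ ≠ 0)
    (h01 : lmap c₁ c₂ (u 0) = lmap c₁ c₂ (u 1)) (h12 : lmap c₁ c₂ (u 1) = lmap c₁ c₂ (u 2)) :
    ∃ j < p + 1, ∃ σ : Equiv.Perm (Fin 7), lineDir p j (u (σ 0)) = lineDir p j (u (σ 1)) ∧
      key7 (fun i => lineDir p j (u (σ i))) ∉ E := by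
  set x : Fin 7 → ZMod p := fun k => lmap c₁ c₂ (u k) with hx
  by_cases hxE : key7 x ∈ E
  swap
  · exact good_of_lmap7 hE2 u c₁ c₂ hc (Equiv.refl _) h01 hxE
  have hx3 : x 3 ≠ x 0 := fun h =>
    key7_not_mem_of_four hE1 x (i := 0) (j := 1) (k := 2) (l := 3) (by decide) (by decide) (by decide) (by decide)
      (by decide) (by decide) h01.symm (h12 ▸ h01).symm h hxE
  set w : ZMod p × ZMod p := u 3 - u 0 with hw
  have hD : c₁ * w.1 + c₂ * w.2 ≠ 0 := by
    intro h; apply hx3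
    have : lmap c₁ c₂ (u 3) - lmap c₁ c₂ (u 0) = 0 := by rw [← map_sub, ← hw, lmap_apply]; exact h
    exact sub_eq_zero.1 this
  set y : Fin 7 → ZMod p := fun k => lmap w.2 (-w.1) (u k) with hy
  have hy03 : y 0 = y 3 := by
    have : lmap w.2 (-w.1) (u 3) - lmap w.2 (-w.1) (u 0) = 0 := by rw [← map_sub, ← hw, lmap_apply]; ring
    exact (sub_eq_zero.1 this).symm
  have hcw : w.2 ≠ 0 ∨ -w.1 ≠ 0 := by
    by_contra h; push Not at h
    apply hD; rw [neg_eq_zero.1 h.2, h.1]; ring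
  by_cases hyE : key7 y ∈ E
  swap
  · obtain ⟨h0, h3⟩ := pairPerm7_apply 0 3 (by decide)
    refine good_of_lmap7 hE2 u w.2 (-w.1) hcw (pairPerm7 0 3) ?_ hyE
    rw [h0, h3]; exact hy03
  obtain ⟨i, j, hne, hm⟩ := h3a x y h01 h12 hxE hy03 hyE
  exact goodS7_of_pair_data hE2 u c₁ c₂ w hD i j hne hm

/-- **Two disjoint coincidences** `x₀ = x₁`, `x₂ = x₃` along `φ₁ = lmap c₁ c₂` ⇒ the goal (pair property `h3b`). [folklore] -/
theorem goodS7_of_twopairs {E : List (List ℕ)} (hE1 : ∀ k ∈ E, ∀ x ∈ k, x ≤ 3)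
    (hE2 : ∀ k ∈ E, ∀ κ : ℕ, 1 ≤ κ → κ < p → scaleVec p κ k ∈ E)
    (h3b : ∀ x y : Fin 7 → ZMod p, x 0 = x 1 → x 2 = x 3 → key7 x ∈ E → y 0 = y 2 → key7 y ∈ E →
      ∃ i j : Fin 7, (x i, y i) ≠ (x j, y j) ∧ key7 (fun k => (y i - y j) * x k - (x i - x j) * y k) ∉ E)
    (u : Fin 7 → ZMod p × ZMod p) (c₁ c₂ : ZMod p) (hc : c₁ ≠ 0 ∨ c₂ ≠ 0)
    (h01 : lmap c₁ c₂ (u 0) = lmap c₁ c₂ (u 1)) (h23 : lmap c₁ c₂ (u 2) = lmap c₁ c₂ (u 3)) :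
    ∃ j < p + 1, ∃ σ : Equiv.Perm (Fin 7), lineDir p j (u (σ 0)) = lineDir p j (u (σ 1)) ∧
      key7 (fun i => lineDir p j (u (σ i))) ∉ E := by
  set x : Fin 7 → ZMod p := fun k => lmap c₁ c₂ (u k) with hx
  by_cases hxE : key7 x ∈ E
  swap
  · exact good_of_lmap7 hE2 u c₁ c₂ hc (Equiv.refl _) h01 hxE
  have hx2 : x 2 ≠ x 0 := fun h =>
    key7_not_mem_of_four hE1 x (i := 0) (j := 1) (k := 2) (l := 3) (by decide) (by decide) (by decide) (by decide)
      (by decide) (by decide) h01.symm h (h23.symm.trans h) hxE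
  set w : ZMod p × ZMod p := u 2 - u 0 with hw
  have hD : c₁ * w.1 + c₂ * w.2 ≠ 0 := by
    intro h; apply hx2
    have : lmap c₁ c₂ (u 2) - lmap c₁ c₂ (u 0) = 0 := by rw [← map_sub, ← hw, lmap_apply]; exact h
    exact sub_eq_zero.1 this
  set y : Fin 7 → ZMod p := fun k => lmap w.2 (-w.1) (u k) with hy
  have hy02 : y 0 = y 2 := by
    have : lmap w.2 (-w.1) (u 2) - lmap w.2 (-w.1) (u 0) = 0 := by rw [← map_sub, ← hw, lmap_apply]; ring
    exact (sub_eq_zero.1 this).symm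
  have hcw : w.2 ≠ 0 ∨ -w.1 ≠ 0 := by
    by_contra h; push Not at h
    apply hD; rw [neg_eq_zero.1 h.2, h.1]; ring
  by_cases hyE : key7 y ∈ E
  swap
  · obtain ⟨h0, h2⟩ := pairPerm7_apply 0 2 (by decide)
    refine good_of_lmap7 hE2 u w.2 (-w.1) hcw (pairPerm7 0 2) ?_ hyE
    rw [h0, h2]; exact hy02
  obtain ⟨i, j, hne, hm⟩ := h3b x y h01 h23 hxE hy02 hyE
  exact goodS7_of_pair_data hE2 u c₁ c₂ w hD i j hne hm

/-- Index bookkeeping for two distinct pairs `i < j`, `k < l`. [folklore] -/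
private theorem pairs_overlap7 : ∀ i j k l : Fin 7, i < j → k < l → (i, j) ≠ (k, l) →
    (i ≠ k ∧ i ≠ l ∧ j ≠ k ∧ j ≠ l) ∨ j = k ∨ i = k ∨ i = l ∨ j = l := by decide

/-- **The structural core for part `7`** (`p + 1 < 21`). [folklore] -/
theorem exists_goodS7 (hp : p + 1 < 21) (E : List (List ℕ)) (hE1 : ∀ k ∈ E, ∀ x ∈ k, x ≤ 3)
    (hE2 : ∀ k ∈ E, ∀ κ : ℕ, 1 ≤ κ → κ < p → scaleVec p κ k ∈ E)
    (h3a : ∀ x y : Fin 7 → ZMod p, x 0 = x 1 → x 1 = x 2 → key7 x ∈ E → y 0 = y 3 → key7 y ∈ E →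
      ∃ i j : Fin 7, (x i, y i) ≠ (x j, y j) ∧ key7 (fun k => (y i - y j) * x k - (x i - x j) * y k) ∉ E)
    (h3b : ∀ x y : Fin 7 → ZMod p, x 0 = x 1 → x 2 = x 3 → key7 x ∈ E → y 0 = y 2 → key7 y ∈ E →
      ∃ i j : Fin 7, (x i, y i) ≠ (x j, y j) ∧ key7 (fun k => (y i - y j) * x k - (x i - x j) * y k) ∉ E)
    (u : Fin 7 → ZMod p × ZMod p) :
    ∃ j < p + 1, ∃ σ : Equiv.Perm (Fin 7), lineDir p j (u (σ 0)) = lineDir p j (u (σ 1)) ∧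
      key7 (fun i => lineDir p j (u (σ i))) ∉ E := by
  -- a functional collapsing two given points
  have collapse : ∀ a b : Fin 7, ∀ v : Fin 7 → ZMod p × ZMod p, v a ≠ v b →
      let w := v a - v b
      (w.2 ≠ 0 ∨ -w.1 ≠ 0) ∧ lmap w.2 (-w.1) (v a) = lmap w.2 (-w.1) (v b) := by
    intro a b v hab
    refine ⟨?_, ?_⟩
    · by_contra h; push Not at h
      exact hab (sub_eq_zero.1 (Prod.ext (neg_eq_zero.1 h.2) h.1))
    · have : lmap (v a - v b).2 (-(v a - v b).1) (v a - v b) = 0 := by rw [lmap_apply]; ring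
      rwa [map_sub, sub_eq_zero] at this
  by_cases hinj : Function.Injective u
  swap
  · -- a repeated point: relabel it to `0, 1`
    rw [Function.Injective] at hinj
    push Not at hinj
    obtain ⟨i, i', e, hne⟩ := hinj
    obtain ⟨h0, h1⟩ := pairPerm7_apply i i' hne
    apply goal_of_perm7 (pairPerm7 i i')
    set v : Fin 7 → ZMod p × ZMod p := fun k => u (pairPerm7 i i' k) with hv
    have hv01 : v 0 = v 1 := by simp only [hv, h0, h1, e]
    show ∃ j < p + 1, ∃ σ : Equiv.Perm (Fin 7), lineDir p j (v (σ 0)) = lineDir p j (v (σ 1)) ∧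
      key7 (fun i => lineDir p j (v (σ i))) ∉ E
    by_cases hv2 : v 2 = v 0
    · -- three coincident points: collapse the fourth ⇒ four equal values
      obtain ⟨j, hj, e3⟩ := exists_lineDir_eq (v 0) (v 3)
      refine ⟨j, hj, 1, by simp [hv01], ?_⟩
      simp only [Equiv.Perm.coe_one, id_eq]
      exact key7_not_mem_of_four hE1 (fun k => lineDir p j (v k)) (i := 0) (j := 1) (k := 2) (l := 3) (by decide)
        (by decide) (by decide) (by decide) (by decide) (by decide) (by simp [hv01]) (by simp [hv2]) e3.symm
    · obtain ⟨hc, hcol⟩ := collapse 2 0 v hv2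
      refine goodS7_of_triple hE1 hE2 h3a v _ _ hc ?_ ?_
      · simp only [hv01]
      · rw [← hv01]; exact hcol.symm
  -- distinct points: two parallel pairs
  obtain ⟨q, q', hqq, hpar⟩ := exists_parallel_pairs7 hp u
  obtain ⟨⟨i, j⟩, hij⟩ := q
  obtain ⟨⟨k, l⟩, hkl⟩ := q'
  simp only at hij hkl hpar hqq
  have hne : (i, j) ≠ (k, l) := fun h => hqq (Subtype.ext h)
  have huij : u i ≠ u j := fun h => (ne_of_lt hij) (hinj h)
  obtain ⟨hc, hcol⟩ := collapse i j u huij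
  -- `x`-values: `x i = x j` and `x k = x l`
  have hkl' : lmap (u i - u j).2 (-(u i - u j).1) (u k) = lmap (u i - u j).2 (-(u i - u j).1) (u l) := by
    rwa [map_sub, sub_eq_zero] at hpar
  set c₁ := (u i - u j).2 with hc₁
  set c₂ := -(u i - u j).1 with hc₂
  rcases pairs_overlap7 i j k l hij hkl hne with ⟨hik, hil, hjk, hjl⟩ | hjk | hik | hil | hjl
  · -- disjoint pairs
    obtain ⟨e0, e1, e2, e3⟩ := quadPerm7_apply i j k l (ne_of_lt hij) hik hil hjk hjl (ne_of_lt hkl)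
    apply goal_of_perm7 (quadPerm7 i j k l)
    refine goodS7_of_twopairs hE1 hE2 h3b (fun m => u (quadPerm7 i j k l m)) c₁ c₂ hc ?_ ?_
    · show lmap c₁ c₂ (u (quadPerm7 i j k l 0)) = lmap c₁ c₂ (u (quadPerm7 i j k l 1)); rw [e0, e1]; exact hcol
    · show lmap c₁ c₂ (u (quadPerm7 i j k l 2)) = lmap c₁ c₂ (u (quadPerm7 i j k l 3)); rw [e2, e3]; exact hkl'
  · -- j = k: triple i, j, l
    subst hjk
    obtain ⟨e0, e1, e2⟩ := triPerm7_apply i j l (ne_of_lt hij) (ne_of_lt (lt_trans hij hkl)) (ne_of_lt hkl)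
    apply goal_of_perm7 (triPerm7 i j l)
    refine goodS7_of_triple hE1 hE2 h3a (fun m => u (triPerm7 i j l m)) c₁ c₂ hc ?_ ?_
    · show lmap c₁ c₂ (u (triPerm7 i j l 0)) = lmap c₁ c₂ (u (triPerm7 i j l 1)); rw [e0, e1]; exact hcol
    · show lmap c₁ c₂ (u (triPerm7 i j l 1)) = lmap c₁ c₂ (u (triPerm7 i j l 2)); rw [e1, e2]; exact hkl'
  · -- i = k: triple j, i, l
    subst hik
    have hjl : j ≠ l := fun h => hne (by rw [h])
    obtain ⟨e0, e1, e2⟩ := triPerm7_apply j i l (ne_of_lt hij).symm hjl (ne_of_lt hkl)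
    apply goal_of_perm7 (triPerm7 j i l)
    refine goodS7_of_triple hE1 hE2 h3a (fun m => u (triPerm7 j i l m)) c₁ c₂ hc ?_ ?_
    · show lmap c₁ c₂ (u (triPerm7 j i l 0)) = lmap c₁ c₂ (u (triPerm7 j i l 1)); rw [e0, e1]; exact hcol.symm
    · show lmap c₁ c₂ (u (triPerm7 j i l 1)) = lmap c₁ c₂ (u (triPerm7 j i l 2)); rw [e1, e2]; exact hkl'
  · -- i = l: triple j, i, k
    subst hil
    obtain ⟨e0, e1, e2⟩ := triPerm7_apply j i k (ne_of_lt hij).symm (ne_of_lt (lt_trans hkl hij)).symm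
      (ne_of_lt hkl).symm
    apply goal_of_perm7 (triPerm7 j i k)
    refine goodS7_of_triple hE1 hE2 h3a (fun m => u (triPerm7 j i k m)) c₁ c₂ hc ?_ ?_
    · show lmap c₁ c₂ (u (triPerm7 j i k 0)) = lmap c₁ c₂ (u (triPerm7 j i k 1)); rw [e0, e1]; exact hcol.symm
    · show lmap c₁ c₂ (u (triPerm7 j i k 1)) = lmap c₁ c₂ (u (triPerm7 j i k 2)); rw [e1, e2]; exact hkl'.symm
  · -- j = l: triple i, j, k
    subst hjl
    have hik : i ≠ k := fun h => hne (by rw [h])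
    obtain ⟨e0, e1, e2⟩ := triPerm7_apply i j k (ne_of_lt hij) hik (ne_of_lt hkl).symm
    apply goal_of_perm7 (triPerm7 i j k)
    refine goodS7_of_triple hE1 hE2 h3a (fun m => u (triPerm7 i j k m)) c₁ c₂ hc ?_ ?_
    · show lmap c₁ c₂ (u (triPerm7 i j k 0)) = lmap c₁ c₂ (u (triPerm7 i j k 1)); rw [e0, e1]; exact hcol
    · show lmap c₁ c₂ (u (triPerm7 i j k 1)) = lmap c₁ c₂ (u (triPerm7 i j k 2)); rw [e1, e2]; exact hkl'.symm

end Core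

end ZpZpDomino

end Summit.MatrixMultiplication.OmegaCensus
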